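import Summits.Ventures.CertifiedManyBodySolver.Observables.StiffnessThermalLeafAtBeta
import Literature.MathematicalPhysics.QuantumLattice.HubbardNNNHoppingFluxThermal
import HarnessLib

/-!
# The thermal KINETIC hook: a certified sector-Gibbs kinetic ceiling at one `β` feeds the single-temperature KT closure

HONEST FRAMING: ladder R1–R4 with certified numbers; no claim on H/H₀. Cell `pub/hubbard-tc` (MO-S3 ORDER → T_c back-end), seat
`hubbard-tc-mod-2` (KT back-end; crux №3 «ROUTE T-A» of the cell, HOME/hubbard-tc-mod-2/KT-THERMAL-INTERFACE.md §1–§2).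

WHAT THIS IS NOT: not a T_c of any material; not a thermal certificate (none exists in the tree today for the kinetic energy at
`β = 4`); not a theorem that the Hubbard model has a Kosterlitz–Thouless transition. It is the ADAPTER that turns the one number a
T > 0 certificate family (e.g. sr-mbsolver/hubbard-thermal's EEB/KMS relaxation with `q = 0` rows) would deliver — an upper bound on
the per-site `e₁`-kinetic expectation `Re⟨kinOpTT'⟩_{β,p}/L²` of the canonical `(N_L, S^z = 0)` sector Gibbs state, valid at every
large side `L` — into the single-temperature leaf `ObsThermalStiffnessSeqCeilingAtBeta` (p465853) and hence, under the monotonicity-free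
thermal KT dictionary, into the row «`T_KT ≤ 1/β`».

* `ObsThermalStiffnessSeqCeilingAtBeta_of_kinetic_eventually` — Paramekanti–Trivedi–Randeria's thermal f-sum step
  (`thermalStiffnessTT'_mul_sq_le_kinetic`: `ρ_s L² ≤ ½ Re⟨kinOpTT'⟩_{β,p}`) along the sequence: if eventually in `L` the sector Gibbs
  state at `β` has `Re⟨kinOpTT'⟩_{β,p}/(2L²) ≤ c`, then the leaf holds at `β` with constant `c`.
* `ThermalKTDictionaryAt.le_inv_of_kinetic_eventually` — composed with `le_inv_of_leafAtBeta`: `(π/4)·c < 1/β ⇒ Tc ≤ 1/β`.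
* `ThermalKTDictionaryAt.le_quarter_of_kinetic_eventually_four` — the row form at `(8, ⅞, 0)`, `β = 4`: a certified per-site
  `Re⟨kinOpTT'⟩/(2L²) ≤ c < 0.3183098` (i.e. `⟨−k_x⟩ ≤ 0.6366`, `⟨−k⟩ ≤ 1.2732` per site) gives `Tc ≤ 1/4`.

References: ParamekantiTrivediRanderia1998 eq. (3), §IV; HazraVermaRanderia2019 eqs. (2)–(4); ScalapinoWhiteZhang1993 §II.
-/

noncomputable section

namespace Summit.Ventures.CertifiedManyBodySolver.Observables

open Filter Topology Set Real Matrix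
open Literature.MathematicalPhysics.QuantumLattice
open Literature.MathematicalPhysics.QuantumFieldTheory
open Literature.MathematicalPhysics.StatisticalMechanics
open Literature.MathematicalPhysics.StatisticalMechanics.KosterlitzThouless
open scoped ComplexConjugate ComplexOrder

/-- **Thermal kinetic ceiling, eventually in `L`, ⇒ the single-temperature stiffness leaf.** Anchor `(U, n, t′)`, inverse temperature
`β > 0`. Hypothesis: for all sufficiently large sides `L`, the canonical `(N_L, S^z = 0)` sector Gibbs state of `hubbardTorusTT' L 1 t′ U`
at `β` (`N_L = 2⌊nL²/2⌋`, written `2⌊(1 − (1 − n))L²/2⌋` verbatim as in the binder of `thermalFluxLogZ L tp U (1 − n) β θ` so that the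
sector subtype matches definitionally) satisfies `Re⟨kinOpTT' L t′⟩_{β,p} / (2L²) ≤ c` — this is what a certified
thermal expectation bound on the `e₁`-kinetic word delivers. Conclusion: `ObsThermalStiffnessSeqCeilingAtBeta tp U n β c`, by the thermal
f-sum inequality `ρ_s L² ≤ ½ Re⟨kinOpTT'⟩_{β,p}` at one large side of the given sequence. No bathtub, no monotonicity.
[cite: ParamekantiTrivediRanderia1998, eq. (3) and §IV] -/
theorem ObsThermalStiffnessSeqCeilingAtBeta_of_kinetic_eventually {tp U n β : ℝ} (hβ : 0 < β) {c : ℚ}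
    (hkin : ∀ᶠ L : ℕ in atTop, ∀ [NeZero L],
      (gibbsState β
          ((hubbardTorusTT' L 1 tp U).toBlock
            (fun s : Finset (Orb (FermionTorus 2 L)) =>
              s.card = 2 * ⌊(1 - (1 - n)) * (L : ℝ) ^ 2 / 2⌋₊ ∧
                2 * (s.filter fun i => (ofLex i).2 = 0).card = 2 * ⌊(1 - (1 - n)) * (L : ℝ) ^ 2 / 2⌋₊)
            (fun s : Finset (Orb (FermionTorus 2 L)) =>
              s.card = 2 * ⌊(1 - (1 - n)) * (L : ℝ) ^ 2 / 2⌋₊ ∧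
                2 * (s.filter fun i => (ofLex i).2 = 0).card = 2 * ⌊(1 - (1 - n)) * (L : ℝ) ^ 2 / 2⌋₊))
          ((kinOpTT' L tp).toBlock
            (fun s : Finset (Orb (FermionTorus 2 L)) =>
              s.card = 2 * ⌊(1 - (1 - n)) * (L : ℝ) ^ 2 / 2⌋₊ ∧
                2 * (s.filter fun i => (ofLex i).2 = 0).card = 2 * ⌊(1 - (1 - n)) * (L : ℝ) ^ 2 / 2⌋₊)
            (fun s : Finset (Orb (FermionTorus 2 L)) =>
              s.card = 2 * ⌊(1 - (1 - n)) * (L : ℝ) ^ 2 / 2⌋₊ ∧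
                2 * (s.filter fun i => (ofLex i).2 = 0).card = 2 * ⌊(1 - (1 - n)) * (L : ℝ) ^ 2 / 2⌋₊))).re /
        (2 * (L : ℝ) ^ 2) ≤ ((c : ℚ) : ℝ)) :
    ObsThermalStiffnessSeqCeilingAtBeta tp U n β c := by
  intro ρs θ₀ hρs hθ₀ Ls hLs hst
  -- along the sequence: eventually `Ls j ≥ 3` and the kinetic ceiling holds at `Ls j`
  have hev : ∀ᶠ j in atTop, 3 ≤ Ls j ∧ ∀ [NeZero (Ls j)],
      (gibbsState β
          ((hubbardTorusTT' (Ls j) 1 tp U).toBlock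
            (fun s : Finset (Orb (FermionTorus 2 (Ls j))) =>
              s.card = 2 * ⌊(1 - (1 - n)) * ((Ls j : ℕ) : ℝ) ^ 2 / 2⌋₊ ∧
                2 * (s.filter fun i => (ofLex i).2 = 0).card = 2 * ⌊(1 - (1 - n)) * ((Ls j : ℕ) : ℝ) ^ 2 / 2⌋₊)
            (fun s : Finset (Orb (FermionTorus 2 (Ls j))) =>
              s.card = 2 * ⌊(1 - (1 - n)) * ((Ls j : ℕ) : ℝ) ^ 2 / 2⌋₊ ∧
                2 * (s.filter fun i => (ofLex i).2 = 0).card = 2 * ⌊(1 - (1 - n)) * ((Ls j : ℕ) : ℝ) ^ 2 / 2⌋₊))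
          ((kinOpTT' (Ls j) tp).toBlock
            (fun s : Finset (Orb (FermionTorus 2 (Ls j))) =>
              s.card = 2 * ⌊(1 - (1 - n)) * ((Ls j : ℕ) : ℝ) ^ 2 / 2⌋₊ ∧
                2 * (s.filter fun i => (ofLex i).2 = 0).card = 2 * ⌊(1 - (1 - n)) * ((Ls j : ℕ) : ℝ) ^ 2 / 2⌋₊)
            (fun s : Finset (Orb (FermionTorus 2 (Ls j))) =>
              s.card = 2 * ⌊(1 - (1 - n)) * ((Ls j : ℕ) : ℝ) ^ 2 / 2⌋₊ ∧
                2 * (s.filter fun i => (ofLex i).2 = 0).card = 2 * ⌊(1 - (1 - n)) * ((Ls j : ℕ) : ℝ) ^ 2 / 2⌋₊))).re /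
        (2 * ((Ls j : ℕ) : ℝ) ^ 2) ≤ ((c : ℚ) : ℝ) :=
    (hLs.eventually_ge_atTop 3).and (hLs.eventually hkin)
  obtain ⟨j, hj3, hjk⟩ := hev.exists
  haveI : NeZero (Ls j) := ⟨by omega⟩
  have hL0 : (0 : ℝ) < ((Ls j : ℕ) : ℝ) := by exact_mod_cast (show 0 < Ls j by omega)
  have hL2 : (0 : ℝ) < ((Ls j : ℕ) : ℝ) ^ 2 := by positivity
  -- the thermal f-sum inequality at side `Ls j`
  have hfsum := thermalStiffnessTT'_mul_sq_le_kinetic (L := Ls j) hj3 tp U hβ hρs hθ₀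
    (fun s : Finset (Orb (FermionTorus 2 (Ls j))) =>
      s.card = 2 * ⌊(1 - (1 - n)) * ((Ls j : ℕ) : ℝ) ^ 2 / 2⌋₊ ∧
        2 * (s.filter fun i => (ofLex i).2 = 0).card = 2 * ⌊(1 - (1 - n)) * ((Ls j : ℕ) : ℝ) ^ 2 / 2⌋₊)
    (by
      intro θ hθ
      have h := hst j θ hθ
      simpa only [thermalFluxLogZ] using h)
  have hk := hjk
  -- `ρs L² ≤ K/2` and `K/(2L²) ≤ c` ⇒ `ρs ≤ c`
  rw [div_le_iff₀ (by positivity)] at hk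
  nlinarith

namespace ThermalKTDictionaryAt

variable {tp U n : ℝ} {ρe : ℝ → ℝ} {Tc : ℝ}

/-- **ROUTE T-A, kernel form: one certified thermal kinetic ceiling at `β` + `(π/4)c < 1/β` ⇒ `Tc ≤ 1/β`.** The hypothesis is the
eventually-in-`L` kinetic ceiling of `ObsThermalStiffnessSeqCeilingAtBeta_of_kinetic_eventually`; the dictionary is the
monotonicity-free `ThermalKTDictionaryAt` (K2 stability + K1t identification). [cite: HazraVermaRanderia2019, eqs. (2)–(4)] -/
theorem le_inv_of_kinetic_eventually (h : ThermalKTDictionaryAt tp U n ρe Tc) {β : ℝ} (hβ : 0 < β) {c : ℚ}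
    (hkin : ∀ᶠ L : ℕ in atTop, ∀ [NeZero L],
      (gibbsState β
          ((hubbardTorusTT' L 1 tp U).toBlock
            (fun s : Finset (Orb (FermionTorus 2 L)) =>
              s.card = 2 * ⌊(1 - (1 - n)) * (L : ℝ) ^ 2 / 2⌋₊ ∧
                2 * (s.filter fun i => (ofLex i).2 = 0).card = 2 * ⌊(1 - (1 - n)) * (L : ℝ) ^ 2 / 2⌋₊)
            (fun s : Finset (Orb (FermionTorus 2 L)) =>
              s.card = 2 * ⌊(1 - (1 - n)) * (L : ℝ) ^ 2 / 2⌋₊ ∧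
                2 * (s.filter fun i => (ofLex i).2 = 0).card = 2 * ⌊(1 - (1 - n)) * (L : ℝ) ^ 2 / 2⌋₊))
          ((kinOpTT' L tp).toBlock
            (fun s : Finset (Orb (FermionTorus 2 L)) =>
              s.card = 2 * ⌊(1 - (1 - n)) * (L : ℝ) ^ 2 / 2⌋₊ ∧
                2 * (s.filter fun i => (ofLex i).2 = 0).card = 2 * ⌊(1 - (1 - n)) * (L : ℝ) ^ 2 / 2⌋₊)
            (fun s : Finset (Orb (FermionTorus 2 L)) =>
              s.card = 2 * ⌊(1 - (1 - n)) * (L : ℝ) ^ 2 / 2⌋₊ ∧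
                2 * (s.filter fun i => (ofLex i).2 = 0).card = 2 * ⌊(1 - (1 - n)) * (L : ℝ) ^ 2 / 2⌋₊))).re /
        (2 * (L : ℝ) ^ 2) ≤ ((c : ℚ) : ℝ))
    (hlt : π / 4 * ((c : ℚ) : ℝ) < 1 / β) : Tc ≤ 1 / β :=
  h.le_inv_of_leafAtBeta hβ (ObsThermalStiffnessSeqCeilingAtBeta_of_kinetic_eventually hβ hkin) hlt

/-- **Row form at `(8, ⅞, 0)`, `β = 4` (the cell's crux №3 target «T_KT ≤ t/4»).** A certified per-site thermal `e₁`-kinetic ceiling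
`Re⟨kinOpTT' L 0⟩_{β=4,p}/(2L²) ≤ c` for all large `L` with `c < 0.3183098` (equivalently `⟨−k_x⟩ ≤ 2c < 0.6366196`, total kinetic
`⟨−k⟩ < 1.2732` per site) gives `Tc ≤ 1/4` for every profile obeying the thermal KT dictionary at `(8, ⅞, 0)`.
[cite: HazraVermaRanderia2019, eqs. (2)–(4)] -/
theorem le_quarter_of_kinetic_eventually_four {ρe : ℝ → ℝ} {Tc : ℝ} (h : ThermalKTDictionaryAt 0 8 (7 / 8) ρe Tc)
    {c : ℚ}
    (hkin : ∀ᶠ L : ℕ in atTop, ∀ [NeZero L],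
      (gibbsState 4
          ((hubbardTorusTT' L 1 0 8).toBlock
            (fun s : Finset (Orb (FermionTorus 2 L)) =>
              s.card = 2 * ⌊(1 - (1 - (7 / 8 : ℝ))) * (L : ℝ) ^ 2 / 2⌋₊ ∧
                2 * (s.filter fun i => (ofLex i).2 = 0).card = 2 * ⌊(1 - (1 - (7 / 8 : ℝ))) * (L : ℝ) ^ 2 / 2⌋₊)
            (fun s : Finset (Orb (FermionTorus 2 L)) =>
              s.card = 2 * ⌊(1 - (1 - (7 / 8 : ℝ))) * (L : ℝ) ^ 2 / 2⌋₊ ∧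
                2 * (s.filter fun i => (ofLex i).2 = 0).card = 2 * ⌊(1 - (1 - (7 / 8 : ℝ))) * (L : ℝ) ^ 2 / 2⌋₊))
          ((kinOpTT' L 0).toBlock
            (fun s : Finset (Orb (FermionTorus 2 L)) =>
              s.card = 2 * ⌊(1 - (1 - (7 / 8 : ℝ))) * (L : ℝ) ^ 2 / 2⌋₊ ∧
                2 * (s.filter fun i => (ofLex i).2 = 0).card = 2 * ⌊(1 - (1 - (7 / 8 : ℝ))) * (L : ℝ) ^ 2 / 2⌋₊)
            (fun s : Finset (Orb (FermionTorus 2 L)) =>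
              s.card = 2 * ⌊(1 - (1 - (7 / 8 : ℝ))) * (L : ℝ) ^ 2 / 2⌋₊ ∧
                2 * (s.filter fun i => (ofLex i).2 = 0).card = 2 * ⌊(1 - (1 - (7 / 8 : ℝ))) * (L : ℝ) ^ 2 / 2⌋₊))).re /
        (2 * (L : ℝ) ^ 2) ≤ ((c : ℚ) : ℝ))
    (hc : ((c : ℚ) : ℝ) < 0.3183098) : Tc ≤ 1 / 4 :=
  h.le_quarter_of_leafAtBeta_four (ObsThermalStiffnessSeqCeilingAtBeta_of_kinetic_eventually (by norm_num) hkin) hc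

end ThermalKTDictionaryAt

/-! ## The `ε`-robust and subsequence forms of the kinetic hook (the shapes a torus-limit reader delivers)

A `T > 0` certificate read through an infinite-volume state — a torus limit `ω` of the canonical-sector Gibbs states at `β`
(sr-mbsolver/hubbard-thermal's reader `IsTorusLimitOfMixture.re_expect_ge_of_thermal_certificate_symm_TT'_of_sectorGibbs` with
`IsTorusLimitOfMixture.tendsto_meanEnergy_hubbardTTPrime`, plus mixture compactness) — does not hand over the kinetic ceiling at
every large side with the certified constant, but only UP TO `ε` (a `limsup` statement), or only along a SUBSEQUENCE of any given
sequence of sides. Both suffice, with the SAME constant `c` and no margin spent: the conclusion `ρ_s ≤ c` of the leaf is a closed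
condition (`le_of_forall_pos_le_add`), and the leaf's own stiffness hypothesis holds at EVERY side of its sequence, so ONE good
side per `ε` is enough.

* `ObsThermalStiffnessSeqCeilingAtBeta_of_kinetic_frequently_add` — the weakest form: along every sequence of sides `L_j → ∞`
  and for every `ε > 0`, FREQUENTLY in `j` the sector Gibbs state at side `L_j` has `Re⟨kinOpTT'⟩_{β,p}/(2L_j²) ≤ c + ε`.
* `ObsThermalStiffnessSeqCeilingAtBeta_of_kinetic_eventually_add` — the `limsup` form: `∀ ε > 0, ∀ᶠ L, … ≤ c + ε`.
* `ObsThermalStiffnessSeqCeilingAtBeta_of_kinetic_subseq_add` — the compactness form: every sequence of sides `L_j → ∞` has a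
  subsequence `L_{φ j}` along which `∀ ε > 0, ∀ᶠ j, … ≤ c + ε` (e.g. the subsequence along which the sector Gibbs states converge
  to a torus limit `ω` with `Re ω(e₁-kinetic word per site)/2 ≤ c`).
* `ThermalKTDictionaryAt.le_inv_of_kinetic_eventually_add` / `….le_inv_of_kinetic_subseq_add` — the closures
  `(π/4)·c < 1/β ⇒ Tc ≤ 1/β`; `….le_quarter_of_kinetic_eventually_add_four` — the row form at `(8, ⅞, 0)`, `β = 4`:
  `c < 0.3183098 ⇒ Tc ≤ 1/4`.
-/

/-- **Kinetic ceiling up to `ε`, frequently along every divergent sequence of sides, ⇒ the single-temperature leaf** (the weakest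
hypothesis of the family; anchor `(U, n, t′)`, `β > 0`). Hypothesis: for every sequence of sides `L_j → ∞` and every `ε > 0`,
frequently in `j` the canonical `(N_L, S^z = 0)` sector Gibbs state at `β` and side `L_j` satisfies
`Re⟨kinOpTT' L_j t′⟩_{β,p}/(2L_j²) ≤ c + ε`. Conclusion: `ObsThermalStiffnessSeqCeilingAtBeta tp U n β c` with the constant `c`
itself. Proof: given the stiffness hypothesis along `L_j` and `ε > 0`, pick one index with `L_j ≥ 3` where the kinetic bound holds;
Paramekanti–Trivedi–Randeria's thermal f-sum inequality `ρ_s L² ≤ ½ Re⟨kinOpTT'⟩_{β,p}` there gives `ρ_s ≤ c + ε`; let `ε → 0`.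
[cite: ParamekantiTrivediRanderia1998, eq. (3) and §IV] -/
theorem ObsThermalStiffnessSeqCeilingAtBeta_of_kinetic_frequently_add {tp U n β : ℝ} (hβ : 0 < β) {c : ℚ}
    (hkin : ∀ Ls : ℕ → ℕ, Tendsto Ls atTop atTop → ∀ ε : ℝ, 0 < ε → ∃ᶠ j : ℕ in atTop, ∀ [NeZero (Ls j)],
      (gibbsState β
          ((hubbardTorusTT' (Ls j) 1 tp U).toBlock
            (fun s : Finset (Orb (FermionTorus 2 (Ls j))) =>
              s.card = 2 * ⌊(1 - (1 - n)) * ((Ls j : ℕ) : ℝ) ^ 2 / 2⌋₊ ∧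
                2 * (s.filter fun i => (ofLex i).2 = 0).card = 2 * ⌊(1 - (1 - n)) * ((Ls j : ℕ) : ℝ) ^ 2 / 2⌋₊)
            (fun s : Finset (Orb (FermionTorus 2 (Ls j))) =>
              s.card = 2 * ⌊(1 - (1 - n)) * ((Ls j : ℕ) : ℝ) ^ 2 / 2⌋₊ ∧
                2 * (s.filter fun i => (ofLex i).2 = 0).card = 2 * ⌊(1 - (1 - n)) * ((Ls j : ℕ) : ℝ) ^ 2 / 2⌋₊))
          ((kinOpTT' (Ls j) tp).toBlock
            (fun s : Finset (Orb (FermionTorus 2 (Ls j))) =>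
              s.card = 2 * ⌊(1 - (1 - n)) * ((Ls j : ℕ) : ℝ) ^ 2 / 2⌋₊ ∧
                2 * (s.filter fun i => (ofLex i).2 = 0).card = 2 * ⌊(1 - (1 - n)) * ((Ls j : ℕ) : ℝ) ^ 2 / 2⌋₊)
            (fun s : Finset (Orb (FermionTorus 2 (Ls j))) =>
              s.card = 2 * ⌊(1 - (1 - n)) * ((Ls j : ℕ) : ℝ) ^ 2 / 2⌋₊ ∧
                2 * (s.filter fun i => (ofLex i).2 = 0).card = 2 * ⌊(1 - (1 - n)) * ((Ls j : ℕ) : ℝ) ^ 2 / 2⌋₊))).re /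
        (2 * ((Ls j : ℕ) : ℝ) ^ 2) ≤ ((c : ℚ) : ℝ) + ε) :
    ObsThermalStiffnessSeqCeilingAtBeta tp U n β c := by
  intro ρs θ₀ hρs hθ₀ Ls hLs hst
  refine le_of_forall_pos_le_add fun ε hε => ?_
  -- one index of the sequence with `Ls j ≥ 3` where the kinetic ceiling `≤ c + ε` holds
  obtain ⟨j, hjk, hj3⟩ := ((hkin Ls hLs ε hε).and_eventually (hLs.eventually_ge_atTop 3)).exists
  haveI : NeZero (Ls j) := ⟨by omega⟩
  have hL0 : (0 : ℝ) < ((Ls j : ℕ) : ℝ) := by exact_mod_cast (show 0 < Ls j by omega)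
  have hL2 : (0 : ℝ) < ((Ls j : ℕ) : ℝ) ^ 2 := by positivity
  -- the thermal f-sum inequality at side `Ls j`
  have hfsum := thermalStiffnessTT'_mul_sq_le_kinetic (L := Ls j) hj3 tp U hβ hρs hθ₀
    (fun s : Finset (Orb (FermionTorus 2 (Ls j))) =>
      s.card = 2 * ⌊(1 - (1 - n)) * ((Ls j : ℕ) : ℝ) ^ 2 / 2⌋₊ ∧
        2 * (s.filter fun i => (ofLex i).2 = 0).card = 2 * ⌊(1 - (1 - n)) * ((Ls j : ℕ) : ℝ) ^ 2 / 2⌋₊)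
    (by
      intro θ hθ
      have h := hst j θ hθ
      simpa only [thermalFluxLogZ] using h)
  have hk := hjk
  -- `ρs L² ≤ K/2` and `K/(2L²) ≤ c + ε` ⇒ `ρs ≤ c + ε`
  rw [div_le_iff₀ (by positivity)] at hk
  nlinarith

/-- **The `limsup` form: kinetic ceiling up to every `ε`, eventually in `L`, ⇒ the single-temperature leaf with the same constant.**
Hypothesis: for every `ε > 0`, for all sufficiently large sides `L`, the canonical-sector Gibbs state at `β` has
`Re⟨kinOpTT' L t′⟩_{β,p}/(2L²) ≤ c + ε` — what `limsup_L ≤ c` says, and what a torus-limit bound `≤ c` for EVERY torus limit of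
the sector Gibbs states gives by compactness. [cite: ParamekantiTrivediRanderia1998, eq. (3) and §IV] -/
theorem ObsThermalStiffnessSeqCeilingAtBeta_of_kinetic_eventually_add {tp U n β : ℝ} (hβ : 0 < β) {c : ℚ}
    (hkin : ∀ ε : ℝ, 0 < ε → ∀ᶠ L : ℕ in atTop, ∀ [NeZero L],
      (gibbsState β
          ((hubbardTorusTT' L 1 tp U).toBlock
            (fun s : Finset (Orb (FermionTorus 2 L)) =>
              s.card = 2 * ⌊(1 - (1 - n)) * (L : ℝ) ^ 2 / 2⌋₊ ∧
                2 * (s.filter fun i => (ofLex i).2 = 0).card = 2 * ⌊(1 - (1 - n)) * (L : ℝ) ^ 2 / 2⌋₊)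
            (fun s : Finset (Orb (FermionTorus 2 L)) =>
              s.card = 2 * ⌊(1 - (1 - n)) * (L : ℝ) ^ 2 / 2⌋₊ ∧
                2 * (s.filter fun i => (ofLex i).2 = 0).card = 2 * ⌊(1 - (1 - n)) * (L : ℝ) ^ 2 / 2⌋₊))
          ((kinOpTT' L tp).toBlock
            (fun s : Finset (Orb (FermionTorus 2 L)) =>
              s.card = 2 * ⌊(1 - (1 - n)) * (L : ℝ) ^ 2 / 2⌋₊ ∧
                2 * (s.filter fun i => (ofLex i).2 = 0).card = 2 * ⌊(1 - (1 - n)) * (L : ℝ) ^ 2 / 2⌋₊)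
            (fun s : Finset (Orb (FermionTorus 2 L)) =>
              s.card = 2 * ⌊(1 - (1 - n)) * (L : ℝ) ^ 2 / 2⌋₊ ∧
                2 * (s.filter fun i => (ofLex i).2 = 0).card = 2 * ⌊(1 - (1 - n)) * (L : ℝ) ^ 2 / 2⌋₊))).re /
        (2 * (L : ℝ) ^ 2) ≤ ((c : ℚ) : ℝ) + ε) :
    ObsThermalStiffnessSeqCeilingAtBeta tp U n β c :=
  ObsThermalStiffnessSeqCeilingAtBeta_of_kinetic_frequently_add hβ fun _Ls hLs ε hε =>
    (hLs.eventually (hkin ε hε)).frequently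

/-- **The subsequence (compactness) form ⇒ the single-temperature leaf with the same constant.** Hypothesis: every sequence of
sides `L_j → ∞` has a subsequence `L_{φ j}` (`φ` strictly increasing) along which, for every `ε > 0`, eventually in `j` the
canonical-sector Gibbs state at `β` has `Re⟨kinOpTT'⟩_{β,p}/(2L_{φ j}²) ≤ c + ε` — e.g. the subsequence along which the sector Gibbs
states converge to a torus limit whose `e₁`-kinetic word per site is `≤ 2c`. [cite: ParamekantiTrivediRanderia1998, eq. (3) and §IV] -/
theorem ObsThermalStiffnessSeqCeilingAtBeta_of_kinetic_subseq_add {tp U n β : ℝ} (hβ : 0 < β) {c : ℚ}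
    (hkin : ∀ Ls : ℕ → ℕ, Tendsto Ls atTop atTop → ∃ φ : ℕ → ℕ, StrictMono φ ∧ ∀ ε : ℝ, 0 < ε →
      ∀ᶠ j : ℕ in atTop, ∀ [NeZero (Ls (φ j))],
      (gibbsState β
          ((hubbardTorusTT' (Ls (φ j)) 1 tp U).toBlock
            (fun s : Finset (Orb (FermionTorus 2 (Ls (φ j)))) =>
              s.card = 2 * ⌊(1 - (1 - n)) * ((Ls (φ j) : ℕ) : ℝ) ^ 2 / 2⌋₊ ∧
                2 * (s.filter fun i => (ofLex i).2 = 0).card = 2 * ⌊(1 - (1 - n)) * ((Ls (φ j) : ℕ) : ℝ) ^ 2 / 2⌋₊)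
            (fun s : Finset (Orb (FermionTorus 2 (Ls (φ j)))) =>
              s.card = 2 * ⌊(1 - (1 - n)) * ((Ls (φ j) : ℕ) : ℝ) ^ 2 / 2⌋₊ ∧
                2 * (s.filter fun i => (ofLex i).2 = 0).card = 2 * ⌊(1 - (1 - n)) * ((Ls (φ j) : ℕ) : ℝ) ^ 2 / 2⌋₊))
          ((kinOpTT' (Ls (φ j)) tp).toBlock
            (fun s : Finset (Orb (FermionTorus 2 (Ls (φ j)))) =>
              s.card = 2 * ⌊(1 - (1 - n)) * ((Ls (φ j) : ℕ) : ℝ) ^ 2 / 2⌋₊ ∧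
                2 * (s.filter fun i => (ofLex i).2 = 0).card = 2 * ⌊(1 - (1 - n)) * ((Ls (φ j) : ℕ) : ℝ) ^ 2 / 2⌋₊)
            (fun s : Finset (Orb (FermionTorus 2 (Ls (φ j)))) =>
              s.card = 2 * ⌊(1 - (1 - n)) * ((Ls (φ j) : ℕ) : ℝ) ^ 2 / 2⌋₊ ∧
                2 * (s.filter fun i => (ofLex i).2 = 0).card = 2 * ⌊(1 - (1 - n)) * ((Ls (φ j) : ℕ) : ℝ) ^ 2 / 2⌋₊))).re /
        (2 * ((Ls (φ j) : ℕ) : ℝ) ^ 2) ≤ ((c : ℚ) : ℝ) + ε) :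
    ObsThermalStiffnessSeqCeilingAtBeta tp U n β c := by
  refine ObsThermalStiffnessSeqCeilingAtBeta_of_kinetic_frequently_add hβ fun Ls hLs ε hε => ?_
  obtain ⟨φ, hφ, hev⟩ := hkin Ls hLs
  exact hφ.tendsto_atTop.frequently (hev ε hε).frequently

namespace ThermalKTDictionaryAt

variable {tp U n : ℝ} {ρe : ℝ → ℝ} {Tc : ℝ}

/-- **ROUTE T-A, `limsup` form: `∀ ε > 0`, eventually in `L`, kinetic ceiling `≤ c + ε` at `β`, and `(π/4)c < 1/β` ⇒ `Tc ≤ 1/β`.**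
Monotonicity-free (dictionary = K2 stability + K1t identification). [cite: HazraVermaRanderia2019, eqs. (2)–(4)] -/
theorem le_inv_of_kinetic_eventually_add (h : ThermalKTDictionaryAt tp U n ρe Tc) {β : ℝ} (hβ : 0 < β) {c : ℚ}
    (hkin : ∀ ε : ℝ, 0 < ε → ∀ᶠ L : ℕ in atTop, ∀ [NeZero L],
      (gibbsState β
          ((hubbardTorusTT' L 1 tp U).toBlock
            (fun s : Finset (Orb (FermionTorus 2 L)) =>
              s.card = 2 * ⌊(1 - (1 - n)) * (L : ℝ) ^ 2 / 2⌋₊ ∧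
                2 * (s.filter fun i => (ofLex i).2 = 0).card = 2 * ⌊(1 - (1 - n)) * (L : ℝ) ^ 2 / 2⌋₊)
            (fun s : Finset (Orb (FermionTorus 2 L)) =>
              s.card = 2 * ⌊(1 - (1 - n)) * (L : ℝ) ^ 2 / 2⌋₊ ∧
                2 * (s.filter fun i => (ofLex i).2 = 0).card = 2 * ⌊(1 - (1 - n)) * (L : ℝ) ^ 2 / 2⌋₊))
          ((kinOpTT' L tp).toBlock
            (fun s : Finset (Orb (FermionTorus 2 L)) =>
              s.card = 2 * ⌊(1 - (1 - n)) * (L : ℝ) ^ 2 / 2⌋₊ ∧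
                2 * (s.filter fun i => (ofLex i).2 = 0).card = 2 * ⌊(1 - (1 - n)) * (L : ℝ) ^ 2 / 2⌋₊)
            (fun s : Finset (Orb (FermionTorus 2 L)) =>
              s.card = 2 * ⌊(1 - (1 - n)) * (L : ℝ) ^ 2 / 2⌋₊ ∧
                2 * (s.filter fun i => (ofLex i).2 = 0).card = 2 * ⌊(1 - (1 - n)) * (L : ℝ) ^ 2 / 2⌋₊))).re /
        (2 * (L : ℝ) ^ 2) ≤ ((c : ℚ) : ℝ) + ε)
    (hlt : π / 4 * ((c : ℚ) : ℝ) < 1 / β) : Tc ≤ 1 / β :=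
  h.le_inv_of_leafAtBeta hβ (ObsThermalStiffnessSeqCeilingAtBeta_of_kinetic_eventually_add hβ hkin) hlt

/-- **ROUTE T-A, subsequence form: every divergent sequence of sides has a subsequence along which the kinetic ceiling holds up to
every `ε` at `β`, and `(π/4)c < 1/β` ⇒ `Tc ≤ 1/β`.** [cite: HazraVermaRanderia2019, eqs. (2)–(4)] -/
theorem le_inv_of_kinetic_subseq_add (h : ThermalKTDictionaryAt tp U n ρe Tc) {β : ℝ} (hβ : 0 < β) {c : ℚ}
    (hkin : ∀ Ls : ℕ → ℕ, Tendsto Ls atTop atTop → ∃ φ : ℕ → ℕ, StrictMono φ ∧ ∀ ε : ℝ, 0 < ε →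
      ∀ᶠ j : ℕ in atTop, ∀ [NeZero (Ls (φ j))],
      (gibbsState β
          ((hubbardTorusTT' (Ls (φ j)) 1 tp U).toBlock
            (fun s : Finset (Orb (FermionTorus 2 (Ls (φ j)))) =>
              s.card = 2 * ⌊(1 - (1 - n)) * ((Ls (φ j) : ℕ) : ℝ) ^ 2 / 2⌋₊ ∧
                2 * (s.filter fun i => (ofLex i).2 = 0).card = 2 * ⌊(1 - (1 - n)) * ((Ls (φ j) : ℕ) : ℝ) ^ 2 / 2⌋₊)
            (fun s : Finset (Orb (FermionTorus 2 (Ls (φ j)))) =>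
              s.card = 2 * ⌊(1 - (1 - n)) * ((Ls (φ j) : ℕ) : ℝ) ^ 2 / 2⌋₊ ∧
                2 * (s.filter fun i => (ofLex i).2 = 0).card = 2 * ⌊(1 - (1 - n)) * ((Ls (φ j) : ℕ) : ℝ) ^ 2 / 2⌋₊))
          ((kinOpTT' (Ls (φ j)) tp).toBlock
            (fun s : Finset (Orb (FermionTorus 2 (Ls (φ j)))) =>
              s.card = 2 * ⌊(1 - (1 - n)) * ((Ls (φ j) : ℕ) : ℝ) ^ 2 / 2⌋₊ ∧
                2 * (s.filter fun i => (ofLex i).2 = 0).card = 2 * ⌊(1 - (1 - n)) * ((Ls (φ j) : ℕ) : ℝ) ^ 2 / 2⌋₊)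
            (fun s : Finset (Orb (FermionTorus 2 (Ls (φ j)))) =>
              s.card = 2 * ⌊(1 - (1 - n)) * ((Ls (φ j) : ℕ) : ℝ) ^ 2 / 2⌋₊ ∧
                2 * (s.filter fun i => (ofLex i).2 = 0).card = 2 * ⌊(1 - (1 - n)) * ((Ls (φ j) : ℕ) : ℝ) ^ 2 / 2⌋₊))).re /
        (2 * ((Ls (φ j) : ℕ) : ℝ) ^ 2) ≤ ((c : ℚ) : ℝ) + ε)
    (hlt : π / 4 * ((c : ℚ) : ℝ) < 1 / β) : Tc ≤ 1 / β :=
  h.le_inv_of_leafAtBeta hβ (ObsThermalStiffnessSeqCeilingAtBeta_of_kinetic_subseq_add hβ hkin) hlt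

/-- **Row form at `(8, ⅞, 0)`, `β = 4`, `limsup` version of the crux №3 target «T_KT ≤ t/4».** If for every `ε > 0`, for all
large `L`, the canonical-sector Gibbs state of `hubbardTorusTT' L 1 0 8` at `β = 4` has `Re⟨kinOpTT' L 0⟩/(2L²) ≤ c + ε` with
`c < 0.3183098` (i.e. `limsup ⟨−k_x⟩ ≤ 2c < 0.6366196` per site), then `Tc ≤ 1/4` for every profile obeying the thermal KT
dictionary at `(8, ⅞, 0)`. [cite: HazraVermaRanderia2019, eqs. (2)–(4)] -/
theorem le_quarter_of_kinetic_eventually_add_four {ρe : ℝ → ℝ} {Tc : ℝ} (h : ThermalKTDictionaryAt 0 8 (7 / 8) ρe Tc)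
    {c : ℚ}
    (hkin : ∀ ε : ℝ, 0 < ε → ∀ᶠ L : ℕ in atTop, ∀ [NeZero L],
      (gibbsState 4
          ((hubbardTorusTT' L 1 0 8).toBlock
            (fun s : Finset (Orb (FermionTorus 2 L)) =>
              s.card = 2 * ⌊(1 - (1 - (7 / 8 : ℝ))) * (L : ℝ) ^ 2 / 2⌋₊ ∧
                2 * (s.filter fun i => (ofLex i).2 = 0).card = 2 * ⌊(1 - (1 - (7 / 8 : ℝ))) * (L : ℝ) ^ 2 / 2⌋₊)
            (fun s : Finset (Orb (FermionTorus 2 L)) =>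
              s.card = 2 * ⌊(1 - (1 - (7 / 8 : ℝ))) * (L : ℝ) ^ 2 / 2⌋₊ ∧
                2 * (s.filter fun i => (ofLex i).2 = 0).card = 2 * ⌊(1 - (1 - (7 / 8 : ℝ))) * (L : ℝ) ^ 2 / 2⌋₊))
          ((kinOpTT' L 0).toBlock
            (fun s : Finset (Orb (FermionTorus 2 L)) =>
              s.card = 2 * ⌊(1 - (1 - (7 / 8 : ℝ))) * (L : ℝ) ^ 2 / 2⌋₊ ∧
                2 * (s.filter fun i => (ofLex i).2 = 0).card = 2 * ⌊(1 - (1 - (7 / 8 : ℝ))) * (L : ℝ) ^ 2 / 2⌋₊)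
            (fun s : Finset (Orb (FermionTorus 2 L)) =>
              s.card = 2 * ⌊(1 - (1 - (7 / 8 : ℝ))) * (L : ℝ) ^ 2 / 2⌋₊ ∧
                2 * (s.filter fun i => (ofLex i).2 = 0).card = 2 * ⌊(1 - (1 - (7 / 8 : ℝ))) * (L : ℝ) ^ 2 / 2⌋₊))).re /
        (2 * (L : ℝ) ^ 2) ≤ ((c : ℚ) : ℝ) + ε)
    (hc : ((c : ℚ) : ℝ) < 0.3183098) : Tc ≤ 1 / 4 :=
  h.le_quarter_of_leafAtBeta_four (ObsThermalStiffnessSeqCeilingAtBeta_of_kinetic_eventually_add (by norm_num) hkin) hc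

end ThermalKTDictionaryAt

end Summit.Ventures.CertifiedManyBodySolver.Observables

end
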